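import Summits.AtomisticToContinuum.BoseEinsteinCondensation.Theorems.FibreConductance.Negative.CosProductState
import Summits.AtomisticToContinuum.BoseEinsteinCondensation.Theorems.FibreConductance.Negative.FibreVocabulary

/-!
# Crux `FibreConductance` (stmt-AtomisticToContinuum-9480) — negative-side toolkit: the lowest-mode
density modulation and its Thomson test function

Refuter (drefute) support file for the line `parseval-shell-bootstrap` (stub 5 `DensityFlattening`).
For the real positive product state `Φ = g^{⊗N}` of `CosProductState.lean` with the LOWEST mode
`n = e₀`, `g = cosRe L e0 a b = a + 2b cos(2πy₀/L)` (`(a² + 2b²)L³ = 1`, `a > 2b ≥ 0`):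
* `Φ = realProd m g` (`cosFun_eq_realProd`), so by `FibreVocabulary` the crux's fibre data are
  `W = bathProd g`, `ψ(X) = g(x₀)` (`fibrePsi_cosFun`): the density charge of the stub is
  `ψ² - L⁻³ = g(x₀)² - L⁻³`;
* the test function `η = e₁(x₀) ∏_{j≠0} g(xⱼ)²` (`etaD`) is `C¹` and periodic, with dual energy
  `∫ Σₗ|∂_{0,l}η|² ψ²/W ≤ 4π²(a+2b)²L` (`lintegral_dual_etaD_le`) and pairing
  `∫_{cellN} (g(x₀)² - L⁻³) η = 2abL³` (`pairing_etaD`: `(g² - L⁻³)e₁ = 2ab + 2ab e₂ + b²e₃ + b²e₋₁`).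
Consumed by `DensityFlatteningCostNearMinimiser.lean`.  All [folklore].
-/

noncomputable section

namespace Summit.AtomisticToContinuum.BoseEinsteinCondensation.Theorems.FibreConductance.Negative

open MeasureTheory Literature.MathematicalPhysics.QuantumManyBody.BoseGas
open Summit.AtomisticToContinuum.BoseEinsteinCondensation.Theorems.GaussianDominationCan.Negative
open scoped ENNReal NNReal ComplexConjugate

variable {m : ℕ} {L a b : ℝ}

/-! ### The lowest-mode profile `g = a + 2b cos(2πy₀/L)` as a real product factor -/

/-- The real profile is continuous. [folklore] -/
theorem continuous_cosRe (L : ℝ) (n : Fin 3 → ℤ) (a b : ℝ) : Continuous (cosRe L n a b) := by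
  unfold cosRe
  exact continuous_const.add (continuous_const.mul
    (Complex.continuous_re.comp (contDiff_cellWave L n).continuous))

/-- `g² = ‖g‖²` pointwise (real profile versus complex factor). [folklore] -/
theorem cosRe_sq_eq_norm_sq (y : Space) : cosRe L e0 a b y ^ 2 = ‖cosBody L e0 a b y‖ ^ 2 := by
  rw [cosBody_eq_ofReal, Complex.norm_real, Real.norm_eq_abs, sq_abs]

/-- `∫_cell g² = 1` under the normalisation `(a² + 2b²)L³ = 1`. [folklore] -/
theorem integral_sq_cosRe (hL : 0 < L) (hab : (a ^ 2 + 2 * b ^ 2) * L ^ 3 = 1) :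
    ∫ y in cell L, cosRe L e0 a b y ^ 2 = 1 := by
  simp_rw [cosRe_sq_eq_norm_sq]
  rw [integral_norm_sq_cosBody hL e0_ne_zero, hab]

/-- `∫_cell g² = 1`, complex form. [folklore] -/
theorem integral_cosBody_sq (hL : 0 < L) (hab : (a ^ 2 + 2 * b ^ 2) * L ^ 3 = 1) :
    ∫ y in cell L, cosBody L e0 a b y ^ 2 = 1 := by
  have h : ∀ y, cosBody L e0 a b y ^ 2 = ((cosRe L e0 a b y ^ 2 : ℝ) : ℂ) := by
    intro y; rw [cosBody_eq_ofReal]; push_cast; ring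
  simp_rw [h]
  rw [integral_complex_ofReal, integral_sq_cosRe hL hab, Complex.ofReal_one]

/-- `∫⁻_cell ofReal g² = 1`. [folklore] -/
theorem lintegral_ofReal_sq_cosRe (hL : 0 < L) (hab : (a ^ 2 + 2 * b ^ 2) * L ^ 3 = 1) :
    ∫⁻ y in cell L, ENNReal.ofReal (cosRe L e0 a b y ^ 2) = 1 := by
  rw [← ofReal_integral_eq_lintegral_ofReal
    ((integrableOn_sq_cell L (continuous_cosBody L e0 a b)).congr_fun
      (fun y _ => (cosRe_sq_eq_norm_sq y).symm) (measurableSet_cell L))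
    (Filter.Eventually.of_forall fun y => sq_nonneg _), integral_sq_cosRe hL hab, ENNReal.ofReal_one]

/-- The witness state is the real product of its profile. [folklore] -/
theorem cosFun_eq_realProd (m : ℕ) (L : ℝ) (a b : ℝ) :
    cosFun m L e0 a b = realProd m (cosRe L e0 a b) := by
  unfold cosFun realProd
  congr 1
  funext _ y
  exact cosBody_eq_ofReal y

/-- **`ψ` of the witness is the profile**: `ψ(X) = g(x₀)`. [folklore] -/
theorem fibrePsi_cosFun (hL : 0 < L) (hab : (a ^ 2 + 2 * b ^ 2) * L ^ 3 = 1) (h2b : 2 * b < a)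
    (hb : 0 ≤ b) (X : Config (m + 1)) :
    fibrePsi L (cosFun m L e0 a b) X = cosRe L e0 a b (X 0) := by
  rw [cosFun_eq_realProd, fibrePsi_realProd (cosRe_pos h2b hb) (integral_sq_cosRe hL hab)]

/-! ### The test function `η = e₁(x₀) ∏_{j≠0} g(xⱼ)²` -/

/-- The factors of `η`: `e₁` for particle `0`, `g²` for the bath. -/
def etaDFactors (m : ℕ) (L a b : ℝ) : Fin (m + 1) → Space → ℂ :=
  Function.update (fun _ : Fin (m + 1) => fun y => cosBody L e0 a b y ^ 2) 0 (oneBody L e0 0 1)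

/-- `η = e₁(x₀) ∏_{j≠0} g(xⱼ)²`. -/
def etaD (m : ℕ) (L a b : ℝ) : Config (m + 1) → ℂ := prodFun (etaDFactors m L a b)

/-- The factor of particle `0` is `e₁`. [folklore] -/
theorem etaDFactors_zero : etaDFactors m L a b 0 = oneBody L e0 0 1 := by
  simp [etaDFactors]

/-- The bath factors are `g²`. [folklore] -/
theorem etaDFactors_of_ne {j : Fin (m + 1)} (hj : j ≠ 0) :
    etaDFactors m L a b j = fun y => cosBody L e0 a b y ^ 2 := by
  simp [etaDFactors, hj]

/-- The factors are `C¹`. [folklore] -/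
theorem contDiff_etaDFactors (j : Fin (m + 1)) : ContDiff ℝ 1 (etaDFactors m L a b j) := by
  by_cases hj : j = 0
  · subst hj; rw [etaDFactors_zero]; exact contDiff_oneBody L e0 0 1
  · rw [etaDFactors_of_ne hj]; exact (contDiff_cosBody L e0 a b).pow 2

/-- The factors are differentiable. [folklore] -/
theorem differentiable_etaDFactors (j : Fin (m + 1)) : Differentiable ℝ (etaDFactors m L a b j) :=
  (contDiff_etaDFactors j).differentiable one_ne_zero

/-- The factors are periodic. [folklore] -/
theorem etaDFactors_periodic (hL : L ≠ 0) (j : Fin (m + 1)) (y : Space) (k : Fin 3) :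
    etaDFactors m L a b j (y + EuclideanSpace.single k L) = etaDFactors m L a b j y := by
  by_cases hj : j = 0
  · subst hj; rw [etaDFactors_zero]; exact oneBody_periodic hL 0 1 y k
  · simp only [etaDFactors_of_ne hj, cosBody_periodic hL]

/-- `η` is `C¹`. [folklore] -/
theorem contDiff_etaD : ContDiff ℝ 1 (etaD m L a b) := contDiff_prodFun contDiff_etaDFactors

/-- `η` is periodic in every particle. [folklore] -/
theorem etaD_periodic (hL : L ≠ 0) (X : Config (m + 1)) (i : Fin (m + 1)) (k : Fin 3) :
    etaD m L a b (X + Pi.single i (EuclideanSpace.single k L)) = etaD m L a b X :=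
  prodFun_periodic (fun j y k => etaDFactors_periodic hL j y k) X i k

/-- The bath part of `η` is `bathProd g` (as a complex number). [folklore] -/
theorem prod_erase_etaDFactors (X : Config (m + 1)) :
    ∏ j ∈ Finset.univ.erase (0 : Fin (m + 1)), etaDFactors m L a b j (X j) =
      ((bathProd (cosRe L e0 a b) X : ℝ) : ℂ) := by
  unfold bathProd
  push_cast
  refine Finset.prod_congr rfl fun j hj => ?_
  simp only [etaDFactors_of_ne (Finset.ne_of_mem_erase hj), cosBody_eq_ofReal]

/-- `|∇e₁|² = 4π²/L²` (for the two-mode function `0 + 1·e₁`). [folklore] -/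
theorem sum_norm_sq_fderiv_e1 (hL : 0 < L) (x : Space) :
    ∑ l : Fin 3, ‖fderiv ℝ (oneBody L e0 0 1) x (EuclideanSpace.single l 1)‖ ^ 2 =
      4 * Real.pi ^ 2 / L ^ 2 := by
  have h := sum_nnnorm_sq_fderiv_oneBody (n := e0) hL 0 1 x
  rw [nsq_e0] at h
  simp_rw [coe_nnnorm_sq_eq_ofReal] at h
  rw [← ENNReal.ofReal_sum_of_nonneg (fun l _ => by positivity)] at h
  have := (ENNReal.ofReal_eq_ofReal_iff (Finset.sum_nonneg fun l _ => by positivity)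
    (by positivity)).mp h
  rw [this]; ring

/-- **The dual energy density of `η`**: `Σₗ |∂_{0,l}η|² = bathProd² · 4π²/L²`. [folklore] -/
theorem sum_norm_sq_fderiv_etaD (hL : 0 < L) (X : Config (m + 1)) :
    ∑ l : Fin 3, ‖fderiv ℝ (etaD m L a b) X (Pi.single 0 (EuclideanSpace.single l (1 : ℝ)))‖ ^ 2 =
      bathProd (cosRe L e0 a b) X ^ 2 * (4 * Real.pi ^ 2 / L ^ 2) := by
  unfold etaD
  simp_rw [fderiv_prodFun differentiable_etaDFactors X 0, norm_mul, mul_pow, prod_erase_etaDFactors,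
    Complex.norm_real, Real.norm_eq_abs, sq_abs]
  rw [← Finset.mul_sum, etaDFactors_zero, sum_norm_sq_fderiv_e1 hL]

/-- `0 < g ≤ a + 2b` (for `0 ≤ b`, `2b < a`). [folklore] -/
theorem cosRe_le (hb : 0 ≤ b) (y : Space) : cosRe L e0 a b y ≤ a + 2 * b := by
  unfold cosRe
  have h := (abs_le.mp (abs_re_cellWave_le L e0 y)).2
  nlinarith

/-- **Pointwise dual bound**: `Σₗ|∂_{0,l}η|² / (W/ψ²) ≤ bathProd · (a+2b)²·4π²/L²`. [folklore] -/
theorem dual_density_etaD_le (hL : 0 < L) (h2b : 2 * b < a) (hb : 0 ≤ b) (X : Config (m + 1)) :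
    (∑ l : Fin 3, ‖fderiv ℝ (etaD m L a b) X (Pi.single 0 (EuclideanSpace.single l (1 : ℝ)))‖ ^ 2) /
        (bathProd (cosRe L e0 a b) X / cosRe L e0 a b (X 0) ^ 2) ≤
      bathProd (cosRe L e0 a b) X * ((a + 2 * b) ^ 2 * (4 * Real.pi ^ 2 / L ^ 2)) := by
  have hφ := cosRe_pos (L := L) (n := e0) h2b hb
  have hB := bathProd_pos hφ X
  have hg := hφ (X 0)
  rw [sum_norm_sq_fderiv_etaD hL, div_div_eq_mul_div, div_le_iff₀ hB]
  have hsq : cosRe L e0 a b (X 0) ^ 2 ≤ (a + 2 * b) ^ 2 :=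
    pow_le_pow_left₀ hg.le (cosRe_le hb (X 0)) 2
  calc bathProd (cosRe L e0 a b) X ^ 2 * (4 * Real.pi ^ 2 / L ^ 2) * cosRe L e0 a b (X 0) ^ 2
      = (bathProd (cosRe L e0 a b) X * (4 * Real.pi ^ 2 / L ^ 2) * bathProd (cosRe L e0 a b) X) *
          cosRe L e0 a b (X 0) ^ 2 := by ring
    _ ≤ (bathProd (cosRe L e0 a b) X * (4 * Real.pi ^ 2 / L ^ 2) * bathProd (cosRe L e0 a b) X) *
          (a + 2 * b) ^ 2 := by gcongr
    _ = bathProd (cosRe L e0 a b) X * ((a + 2 * b) ^ 2 * (4 * Real.pi ^ 2 / L ^ 2)) *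
          bathProd (cosRe L e0 a b) X := by ring

/-- **The dual energy of `η`**: `∫ Σₗ|∂_{0,l}η|² ψ²/W ≤ 4π²(a+2b)²L`. [folklore] -/
theorem lintegral_dual_etaD_le (hL : 0 < L) (hab : (a ^ 2 + 2 * b ^ 2) * L ^ 3 = 1)
    (h2b : 2 * b < a) (hb : 0 ≤ b) :
    ∫⁻ X in cellN (m + 1) L, ENNReal.ofReal
      ((∑ l : Fin 3, ‖fderiv ℝ (etaD m L a b) X (Pi.single 0 (EuclideanSpace.single l (1 : ℝ)))‖ ^ 2) /
        (bathProd (cosRe L e0 a b) X / cosRe L e0 a b (X 0) ^ 2)) ≤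
      ENNReal.ofReal (4 * Real.pi ^ 2 * (a + 2 * b) ^ 2 * L) := by
  have hφ := cosRe_pos (L := L) (n := e0) h2b hb
  set c₁ : ℝ := (a + 2 * b) ^ 2 * (4 * Real.pi ^ 2 / L ^ 2) with hc₁
  have hc₁0 : 0 ≤ c₁ := by positivity
  have hF : Measurable fun y : Space => ENNReal.ofReal (cosRe L e0 a b y ^ 2) :=
    ((continuous_cosRe L e0 a b).pow 2).measurable.ennreal_ofReal
  calc ∫⁻ X in cellN (m + 1) L, ENNReal.ofReal
        ((∑ l : Fin 3, ‖fderiv ℝ (etaD m L a b) X (Pi.single 0 (EuclideanSpace.single l (1 : ℝ)))‖ ^ 2) /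
          (bathProd (cosRe L e0 a b) X / cosRe L e0 a b (X 0) ^ 2))
      ≤ ∫⁻ X in cellN (m + 1) L, ENNReal.ofReal (bathProd (cosRe L e0 a b) X * c₁) :=
        lintegral_mono fun X => ENNReal.ofReal_le_ofReal (dual_density_etaD_le hL h2b hb X)
    _ = ∫⁻ X in cellN (m + 1) L,
          (∏ j ∈ Finset.univ.erase (0 : Fin (m + 1)), ENNReal.ofReal (cosRe L e0 a b (X j) ^ 2)) *
            ENNReal.ofReal c₁ := by
        refine lintegral_congr fun X => ?_
        rw [ENNReal.ofReal_mul (bathProd_pos hφ X).le, bathProd,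
          ENNReal.ofReal_prod_of_nonneg fun j _ => sq_nonneg _]
    _ = ENNReal.ofReal L ^ 3 * ENNReal.ofReal c₁ := by
        rw [lintegral_mul_const' _ _ ENNReal.ofReal_ne_top, lintegral_prod_erase 0 hF]
        simp only [lintegral_ofReal_sq_cosRe hL hab, Finset.prod_const_one, mul_one]
    _ = ENNReal.ofReal (4 * Real.pi ^ 2 * (a + 2 * b) ^ 2 * L) := by
        rw [← ENNReal.ofReal_pow hL.le, ← ENNReal.ofReal_mul (by positivity), hc₁]
        congr 1
        field_simp

/-! ### The pairing `∫ σ η = 2abL³` -/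

/-- The one-body pairing integrand `(g² - L⁻³)·e₁` in plane waves:
`2ab + 2ab e₂ + b² e₃ + b² e₋₁` (using `L⁻³ = a² + 2b²` and `e₁e₋₁ = 1`). [folklore] -/
theorem pairing_integrand_eq (hs : (L ^ 3)⁻¹ = a ^ 2 + 2 * b ^ 2) (y : Space) :
    (((cosRe L e0 a b y ^ 2 - (L ^ 3)⁻¹ : ℝ)) : ℂ) * oneBody L e0 0 1 y =
      (2 * a * b : ℂ) + ((2 * a * b : ℂ) * cellWave L (e0 + e0) y +
        (b ^ 2 : ℂ) * cellWave L (e0 + e0 + e0) y + (b ^ 2 : ℂ) * cellWave L (-e0) y) := by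
  have hE : ((cosRe L e0 a b y : ℝ) : ℂ) = cosBody L e0 a b y := (cosBody_eq_ofReal y).symm
  have h1 : cellWave L e0 y * cellWave L (-e0) y = 1 := by
    rw [← cellWave_add_index, add_neg_cancel, cellWave_zero]
  have hone : oneBody L e0 0 1 y = cellWave L e0 y := by simp [oneBody]
  rw [hs]
  push_cast
  rw [hE, hone]
  simp only [cellWave_add_index]
  unfold cosBody
  linear_combination ((2 * a * b : ℂ) + 2 * (b : ℂ) ^ 2 * cellWave L e0 y +
    (b : ℂ) ^ 2 * cellWave L (-e0) y) * h1

/-- `3e₀ ≠ 0`. [folklore] -/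
theorem three_e0_ne_zero : e0 + e0 + e0 ≠ 0 := by
  intro h
  have h2 := congrFun h 0
  simp [e0] at h2

/-- `∫_cell (g² - L⁻³) e₁ = 2abL³`. [folklore] -/
theorem integral_pairing_factor (hL : 0 < L) (hs : (L ^ 3)⁻¹ = a ^ 2 + 2 * b ^ 2) :
    ∫ y in cell L, (((cosRe L e0 a b y ^ 2 - (L ^ 3)⁻¹ : ℝ)) : ℂ) * oneBody L e0 0 1 y =
      (L : ℂ) ^ 3 * (2 * a * b) := by
  simp_rw [pairing_integrand_eq hs]
  have h2 : e0 + e0 ≠ 0 := add_self_ne_zero e0_ne_zero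
  have hm : -e0 ≠ 0 := neg_ne_zero.mpr e0_ne_zero
  have c1 : Continuous fun y => (2 * a * b : ℂ) * cellWave L (e0 + e0) y := by fun_prop
  have c2 : Continuous fun y => (b ^ 2 : ℂ) * cellWave L (e0 + e0 + e0) y := by fun_prop
  have c3 : Continuous fun y => (b ^ 2 : ℂ) * cellWave L (-e0) y := by fun_prop
  rw [integral_add (integrableOn_cell (f := fun _ => (2 * a * b : ℂ)) continuous_const)
      (integrableOn_cell (f := fun y => (2 * a * b : ℂ) * cellWave L (e0 + e0) y +
        (b ^ 2 : ℂ) * cellWave L (e0 + e0 + e0) y + (b ^ 2 : ℂ) * cellWave L (-e0) y)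
        ((c1.add c2).add c3)),
    integral_add (integrableOn_cell (f := fun y => (2 * a * b : ℂ) * cellWave L (e0 + e0) y +
        (b ^ 2 : ℂ) * cellWave L (e0 + e0 + e0) y) (c1.add c2))
      (integrableOn_cell (f := fun y => (b ^ 2 : ℂ) * cellWave L (-e0) y) c3),
    integral_add (integrableOn_cell (f := fun y => (2 * a * b : ℂ) * cellWave L (e0 + e0) y) c1)
      (integrableOn_cell (f := fun y => (b ^ 2 : ℂ) * cellWave L (e0 + e0 + e0) y) c2)]
  rw [integral_cell_const hL, integral_const_mul, integral_const_mul, integral_const_mul,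
    integral_cell_cellWave_eq_zero hL h2, integral_cell_cellWave_eq_zero hL three_e0_ne_zero,
    integral_cell_cellWave_eq_zero hL hm]
  ring

/-- **The pairing of the density charge with `η`**: `∫_{cellN} (g(x₀)² - L⁻³) η = 2abL³`
(the bath factors integrate to `1`). [folklore] -/
theorem pairing_etaD (hL : 0 < L) (hab : (a ^ 2 + 2 * b ^ 2) * L ^ 3 = 1) :
    ∫ X in cellN (m + 1) L, (((cosRe L e0 a b (X 0) ^ 2 - (L ^ 3)⁻¹ : ℝ)) : ℂ) * etaD m L a b X =
      (L : ℂ) ^ 3 * (2 * a * b) := by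
  have hL3 : L ^ 3 ≠ 0 := by positivity
  have hs : (L ^ 3)⁻¹ = a ^ 2 + 2 * b ^ 2 := ((mul_eq_one_iff_eq_inv₀ hL3).mp hab).symm
  set F := etaDFactors m L a b with hF
  set h : Space → ℂ := fun y =>
    (((cosRe L e0 a b y ^ 2 - (L ^ 3)⁻¹ : ℝ)) : ℂ) * oneBody L e0 0 1 y with hh
  have hpt : ∀ X : Config (m + 1),
      (((cosRe L e0 a b (X 0) ^ 2 - (L ^ 3)⁻¹ : ℝ)) : ℂ) * etaD m L a b X =
        prodFun (Function.update F 0 h) X := by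
    intro X
    rw [etaD, ← hF, prodFun_eq_mul_erase F 0 X, prodFun_update_fun, hh,
      show F 0 = oneBody L e0 0 1 from etaDFactors_zero]
    ring
  simp_rw [hpt]
  have hprod : ∫ X in cellN (m + 1) L, prodFun (Function.update F 0 h) X =
      ∏ j, ∫ y in cell L, Function.update F 0 h j y := integral_cellN_prod _
  have hupd : ∀ j, (∫ y in cell L, Function.update F 0 h j y) =
      Function.update (fun j => ∫ y in cell L, F j y) 0 (∫ y in cell L, h y) j := fun j =>
    Function.apply_update (fun _ (g : Space → ℂ) => ∫ y in cell L, g y) F 0 h j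
  rw [hprod]
  simp_rw [hupd]
  rw [Finset.prod_update_of_mem (Finset.mem_univ _), Finset.sdiff_singleton_eq_erase]
  have hones : ∀ j ∈ Finset.univ.erase (0 : Fin (m + 1)), ∫ y in cell L, F j y = 1 := by
    intro j hj
    rw [hF, etaDFactors_of_ne (Finset.ne_of_mem_erase hj)]
    exact integral_cosBody_sq hL hab
  rw [Finset.prod_congr rfl hones, Finset.prod_const_one, mul_one, hh, integral_pairing_factor hL hs]

end Summit.AtomisticToContinuum.BoseEinsteinCondensation.Theorems.FibreConductance.Negative

end
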